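import Summits.RiemannHypothesis.RiemannHypothesis.Theses.SignCone
import Summits.RiemannHypothesis.RiemannHypothesis.Theorems.SignConeEnvelopeCore
import Literature.NumberTheory.LFunctions.WeilExplicit
import Literature.NumberTheory.LFunctions.WeilExplicitProofs
import Literature.NumberTheory.LFunctions.WeilExplicitContinuous
import Literature.NumberTheory.LFunctions.WeilMellinBounds
import Literature.NumberTheory.LFunctions.WeilArchimedeanPositivityProofs
import Literature.NumberTheory.LFunctions.UniformWeilPositivityRH
import HarnessLib

/-!
# `SignConeFarField` — negative lemmas: load-bearing analysis of the hypotheses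

Refuter (crux disprover) record for the crux `stmt-RiemannHypothesis-16305`
(`Summit.RiemannHypothesis.RiemannHypothesis.Theses.SignCone.SignConeFarField`: for `a > 0` and
`F = Σᵢ gᵢ ⋆ g̃ᵢ` with `tsupport gᵢ ⊆ [-a, a]`, non-negative at the nodes `log n` (`n ≥ 2`) and on the far
field `|t| ≥ log 2`, one has `-Re F(0) ≤ Re W_ar(F)`, `W_ar = weilPolarTerm + weilArchTerm`).
The crux is RH-implied (`SignCone.signConeFarField_of_riemannHypothesis`, landed), so it cannot be refuted
short of `¬ RiemannHypothesis`; this file locates its hypotheses instead (all kernel-checked, sorry-free):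

* `signConeFarField_iff_without_nodes` (**the node hypothesis is decoration**): `Re F(log n) ≥ 0` for
  `n ≥ 2` follows from the far-field hypothesis (`log n ≥ log 2`), so the crux is equivalent to its
  node-free form.
* `signConeFarField_false_without_PD` (**positive-definiteness is load-bearing**): if the
  autocorrelation structure `F = Σᵢ gᵢ ⋆ g̃ᵢ` is replaced by "`F` any smooth function supported in
  `[-2a, 2a]`" (keeping both sign hypotheses and the conclusion verbatim), the statement is FALSE.
  Witness `F = -(b ⋆ b̃)`, `b` the smooth bump of radius `1/3 ≤ (log 2)/2`: `F` vanishes at every node and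
  on the far field (`2/3 ≤ log 2`), `Re W_ar(b ⋆ b̃) = Re Q(b) + Re P_Λ(b ⋆ b̃) ≥ 0` by Yoshida's
  small-support Weil positivity (`weilPositivityOn_of_le_log_two_half`, tree) and `P_Λ = 0`, while
  `Re (b ⋆ b̃)(0) = ∫ b² > 0`; so `-Re F(0) > 0 ≥ Re W_ar(F)`.

Upshot for provers: the proof must use the cone structure of `F`; the route's bookkeeping argument uses
exactly `F(-t) = conj F(t)` and `|F(t)| ≤ Re F(0)` (both consequences of positive-definiteness), the sign
of `w(t) = 2cosh(t/2) - e^{t/2}/(2 sinh t)` (negative on `(0, t_w)`, `t_w = 0.28120`, `e^{t_w}` the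
plastic number) and the far-field sign; the node hypothesis may be discarded at once.
-/

set_option linter.dupNamespace false

noncomputable section

open scoped BigOperators ComplexConjugate
open Complex MeasureTheory Set Filter

namespace Summit.RiemannHypothesis.RiemannHypothesis.Theorems.SignConeFarField.Negative

open Literature.NumberTheory.LFunctions
open Summit.RiemannHypothesis.RiemannHypothesis.Theses.SignCone
open Summit.RiemannHypothesis.RiemannHypothesis.Theorems.SignCone

/-! ## The node hypothesis is decoration -/

/-- Far-field non-negativity implies node non-negativity (`|log n| = log n ≥ log 2` for `n ≥ 2`).
[folklore] -/
theorem nodes_of_farField {F : ℝ → ℂ} (hff : ∀ t : ℝ, Real.log 2 ≤ |t| → 0 ≤ (F t).re) :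
    ∀ n : ℕ, 2 ≤ n → 0 ≤ (F (Real.log n)).re := by
  intro n hn
  refine hff _ ?_
  have h2 : (2 : ℝ) ≤ n := by exact_mod_cast hn
  have hlog : Real.log 2 ≤ Real.log n := Real.log_le_log (by norm_num) h2
  exact hlog.trans (le_abs_self _)

/-- **The node hypothesis is decoration**: the crux is equivalent to the same statement with the
hypothesis `∀ n ≥ 2, 0 ≤ Re F(log n)` deleted (body otherwise verbatim, Mathlib primitives). [folklore] -/
theorem signConeFarField_iff_without_nodes :
    SignConeFarField ↔
      (∀ a : ℝ, 0 < a → ∀ (k : ℕ) (g : Fin k → ℝ → ℂ), (∀ i, (ContDiff ℝ ((⊤ : ℕ∞) : WithTop ℕ∞) (g i) ∧ HasCompactSupport (g i)) ∧ tsupport (g i) ⊆ Set.Icc (-a) a) → let F : ℝ → ℂ := fun t => ∑ i, MeasureTheory.convolution (g i) (fun u => (starRingEnd ℂ) ((g i) (-u))) (ContinuousLinearMap.mul ℂ ℂ) MeasureTheory.MeasureSpace.volume t; (∀ t : ℝ, Real.log 2 ≤ |t| → 0 ≤ (F t).re) → let M : ℂ → ℂ := fun s => ∫ u : ℝ, F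 u * Complex.exp ((s - 1 / 2) * u); -(F 0).re ≤ (M 0 + M 1 + ((1 / (2 * Real.pi) : ℂ) * (∫ t : ℝ, M (1 / 2 + t * Complex.I) * ((Complex.digamma (1 / 4 + t / 2 * Complex.I)).re : ℂ)) - F 0 * (Real.log Real.pi : ℂ))).re) :=
  ⟨fun h a ha k g hg hff => h a ha k g hg (nodes_of_farField hff) hff,
   fun h a ha k g hg _hn hff => h a ha k g hg hff⟩

/-! ## Positive-definiteness is load-bearing -/

/-- `rOut (bump 2) = 1/3`. [folklore] -/
theorem bump2_rOut : (WeilContinuous.bump 2).rOut = 1 / 3 := by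
  rw [WeilContinuous.bump_rOut]
  norm_num

/-- `b(x) = 0` for `|x| ≥ 1/3`. [folklore] -/
theorem bump2_eq_zero {x : ℝ} (hx : 1 / 3 ≤ |x|) : (WeilContinuous.bump 2) x = 0 := by
  apply (WeilContinuous.bump 2).zero_of_le_dist
  rwa [bump2_rOut, Real.dist_eq, sub_zero]

/-- `b(0) = 1`. [folklore] -/
theorem bump2_zero : (WeilContinuous.bump 2) 0 = 1 :=
  (WeilContinuous.bump 2).one_of_mem_closedBall (Metric.mem_closedBall_self (WeilContinuous.bump 2).rIn_pos.le)

/-- The bump as a complex test function. [folklore] -/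
theorem isWeilTest_bump2 : IsWeilTest (fun u : ℝ => (((WeilContinuous.bump 2) u : ℝ) : ℂ)) :=
  ⟨Complex.ofRealCLM.contDiff.comp (WeilContinuous.bump 2).contDiff,
   (WeilContinuous.bump 2).hasCompactSupport.comp_left (g := fun r : ℝ => (r : ℂ)) Complex.ofReal_zero⟩

/-- `2/3 ≤ log 2`. [folklore] -/
theorem two_thirds_le_log_two : (2 / 3 : ℝ) ≤ Real.log 2 := by linarith [Real.log_two_gt_d9]

/-- `tsupport b ⊆ [-(log 2)/2, (log 2)/2]` (`rOut = 1/3 ≤ (log 2)/2`). [folklore] -/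
theorem tsupport_bump2_subset :
    tsupport (fun u : ℝ => (((WeilContinuous.bump 2) u : ℝ) : ℂ)) ⊆ Icc (-(Real.log 2 / 2)) (Real.log 2 / 2) := by
  refine closure_minimal (fun x hx => ?_) isClosed_Icc
  rw [Function.mem_support] at hx
  by_contra h
  rw [mem_Icc, not_and_or, not_le, not_le] at h
  refine hx ?_
  have h13 : 1 / 3 ≤ |x| := by
    rcases h with h | h
    · rw [abs_of_neg (by linarith [two_thirds_le_log_two])]
      linarith [two_thirds_le_log_two]
    · rw [abs_of_pos (by linarith [two_thirds_le_log_two])]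
      linarith [two_thirds_le_log_two]
  simp [bump2_eq_zero h13]

/-- The autocorrelation `G = b ⋆ b̃` as an integral of a REAL non-negative integrand:
`G(t) = ∫ b(u) b(u - t) du`. [folklore] -/
theorem weilConv_bump2_apply (t : ℝ) :
    weilConv (fun u : ℝ => (((WeilContinuous.bump 2) u : ℝ) : ℂ))
        (weilReflect (fun u : ℝ => (((WeilContinuous.bump 2) u : ℝ) : ℂ))) t =
      ((∫ u : ℝ, (WeilContinuous.bump 2) u * (WeilContinuous.bump 2) (u - t) : ℝ) : ℂ) := by
  rw [weilConv_apply, ← integral_complex_ofReal]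
  refine integral_congr_ae (Eventually.of_forall fun u => ?_)
  simp only [weilReflect, neg_sub, Complex.conj_ofReal, Complex.ofReal_mul]

/-- `G(t) = 0` for `|t| ≥ 2/3`: the bumps `b(u)` and `b(u - t)` have disjoint supports. [folklore] -/
theorem weilConv_bump2_eq_zero {t : ℝ} (ht : 2 / 3 ≤ |t|) :
    weilConv (fun u : ℝ => (((WeilContinuous.bump 2) u : ℝ) : ℂ))
        (weilReflect (fun u : ℝ => (((WeilContinuous.bump 2) u : ℝ) : ℂ))) t = 0 := by
  rw [weilConv_bump2_apply]
  have h : ∀ u : ℝ, (WeilContinuous.bump 2) u * (WeilContinuous.bump 2) (u - t) = 0 := by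
    intro u
    by_cases hu : 1 / 3 ≤ |u|
    · rw [bump2_eq_zero hu, zero_mul]
    · push Not at hu
      have hut : 1 / 3 ≤ |u - t| := by
        have h1 : |t| - |u| ≤ |u - t| := by
          have := abs_sub_abs_le_abs_sub t u
          rwa [abs_sub_comm] at this
        linarith
      rw [bump2_eq_zero hut, mul_zero]
  simp [h]

/-- `Re G(0) = ∫ b² > 0`. [folklore] -/
theorem re_weilConv_bump2_zero_pos :
    0 < (weilConv (fun u : ℝ => (((WeilContinuous.bump 2) u : ℝ) : ℂ))
        (weilReflect (fun u : ℝ => (((WeilContinuous.bump 2) u : ℝ) : ℂ))) 0).re := by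
  rw [weilConv_bump2_apply, Complex.ofReal_re]
  simp only [sub_zero]
  have hc : Continuous fun u : ℝ => (WeilContinuous.bump 2) u * (WeilContinuous.bump 2) u :=
    (WeilContinuous.bump 2).continuous.mul (WeilContinuous.bump 2).continuous
  have hsupp : HasCompactSupport fun u : ℝ => (WeilContinuous.bump 2) u * (WeilContinuous.bump 2) u :=
    (WeilContinuous.bump 2).hasCompactSupport.mul_left
  refine integral_pos_of_integrable_nonneg_nonzero (x := 0) hc (hc.integrable_of_hasCompactSupport hsupp)
    (fun u => mul_nonneg ((WeilContinuous.bump 2).nonneg) ((WeilContinuous.bump 2).nonneg)) ?_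
  simp [bump2_zero]

/-- `W_ar(-F) = -W_ar(F)` (no hypotheses: `∫ -f = -∫ f` unconditionally). [folklore] -/
theorem weilArchPolar_neg (F : ℝ → ℂ) :
    weilPolarTerm (fun t => -F t) + weilArchTerm (fun t => -F t) = -(weilPolarTerm F + weilArchTerm F) := by
  have hM : ∀ s, weilMellin (fun t => -F t) s = -weilMellin F s := by
    intro s
    have e : (fun t : ℝ => -F t) = fun t => (-1 : ℂ) * F t := by funext t; ring
    rw [e, weilMellin_const_mul]
    ring
  have hA : weilArchIntegral (fun t => -F t) = -weilArchIntegral F := by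
    unfold weilArchIntegral
    rw [← integral_neg]
    refine integral_congr_ae (Eventually.of_forall fun t => ?_)
    simp only [hM]
    ring
  simp only [weilPolarTerm, weilArchTerm, hM, hA]
  ring

/-- **Positive-definiteness is load-bearing.** The crux with the autocorrelation structure DROPPED — `F` an
arbitrary smooth function supported in `[-2a, 2a]` (where `Σ gᵢ ⋆ g̃ᵢ` would live), same sign hypotheses,
same conclusion — is FALSE. Witness `F = -(b ⋆ b̃)` with `b` the
bump of radius `1/3`: `F` is smooth, supported in `[-2/3, 2/3] ⊆ [-2a, 2a]` (`a = 1`), vanishes at every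
node and on the far field (`2/3 ≤ log 2`), but `Re W_ar(b ⋆ b̃) ≥ 0` (Yoshida: `WeilPositivityOn ((log 2)/2)`,
tree theorem `weilPositivityOn_of_le_log_two_half`, through `re_weilArchPolar_nonneg_of_weilPositivityOn`)
and `Re (b ⋆ b̃)(0) = ∫ b² > 0`, so `-Re F(0) = ∫ b² > 0 ≥ -Re W_ar(b ⋆ b̃) = Re W_ar(F)`. Any proof of the
crux must use the cone structure of `F` (at least `Re F(0) ≥ 0`; the bookkeeping proof uses exactly
`F` hermitian and `|F| ≤ Re F(0)`). [folklore] -/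
theorem signConeFarField_false_without_PD :
    ¬ (∀ a : ℝ, 0 < a → ∀ F : ℝ → ℂ, (ContDiff ℝ ((⊤ : ℕ∞) : WithTop ℕ∞) F ∧ HasCompactSupport F) ∧ tsupport F ⊆ Set.Icc (-(2 * a)) (2 * a) → (∀ n : ℕ, 2 ≤ n → 0 ≤ (F (Real.log n)).re) → (∀ t : ℝ, Real.log 2 ≤ |t| → 0 ≤ (F t).re) → let M : ℂ → ℂ := fun s => ∫ u : ℝ, F u * Complex.exp ((s - 1 / 2) * u); -(F 0).re ≤ (M 0 + M 1 + ((1 / (2 * Real.pi) : ℂ) * (∫ t : ℝ, M (1 / 2 + t * Complex.I) * ((Complex.digamma (1 / 4 + t / 2 * Complex.I)).re : ℂ)) - F 0 * (Real.log Real.pi : ℂ))).re) := by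
  intro h
  set b : ℝ → ℂ := fun u : ℝ => (((WeilContinuous.bump 2) u : ℝ) : ℂ) with hb
  set G : ℝ → ℂ := weilConv b (weilReflect b) with hGdef
  have hbt : IsWeilTest b := isWeilTest_bump2
  have hGt : IsWeilTest G := hbt.weilConv hbt.weilReflect
  have hGsupp : tsupport G ⊆ Icc (-(2 * (Real.log 2 / 2))) (2 * (Real.log 2 / 2)) :=
    tsupport_weilConv_weilReflect_subset hbt.2 tsupport_bump2_subset
  set F : ℝ → ℂ := fun t => -G t with hFdef
  have hFt : IsWeilTest F := by
    have e : F = fun t => (-1 : ℂ) * G t := by funext t; simp [hFdef]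
    rw [e]
    exact hGt.const_mul (-1)
  have hFsupp : tsupport F ⊆ Icc (-(2 * (1 : ℝ))) (2 * 1) := by
    have e : F = fun t => (-1 : ℂ) * G t := by funext t; simp [hFdef]
    have h1 : tsupport F ⊆ tsupport G := by
      rw [e]
      exact tsupport_mul_subset_right
    refine h1.trans (hGsupp.trans ?_)
    intro x hx
    simp only [mem_Icc] at hx ⊢
    constructor <;> nlinarith [Real.log_two_lt_d9]
  have hGzero : ∀ t : ℝ, Real.log 2 ≤ |t| → G t = 0 := fun t ht =>
    weilConv_bump2_eq_zero (two_thirds_le_log_two.trans ht)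
  have hnodes : ∀ n : ℕ, 2 ≤ n → 0 ≤ (F (Real.log n)).re := by
    intro n hn
    have h2 : (2 : ℝ) ≤ n := by exact_mod_cast hn
    have hlog : Real.log 2 ≤ |Real.log n| :=
      (Real.log_le_log (by norm_num) h2).trans (le_abs_self _)
    simp [hFdef, hGzero _ hlog]
  have hff : ∀ t : ℝ, Real.log 2 ≤ |t| → 0 ≤ (F t).re := by
    intro t ht
    simp [hFdef, hGzero _ ht]
  -- the (false) inequality at the witness
  have key : -(F 0).re ≤ (weilPolarTerm F + weilArchTerm F).re := h 1 one_pos F ⟨hFt, hFsupp⟩ hnodes hff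
  -- `Re W_ar(G) ≥ 0` by Yoshida's small-support positivity, and `W_ar(F) = -W_ar(G)`
  have hGpos : 0 ≤ (weilPolarTerm G + weilArchTerm G).re := by
    have hdec : weilPolarTerm G + weilArchTerm G = weilFunctional G + weilPrimeTerm G := by
      unfold weilFunctional
      ring
    have hQ : 0 ≤ (weilFunctional G).re :=
      weilPositivityOn_of_le_log_two_half le_rfl b hbt tsupport_bump2_subset
    have hsym : ∀ t : ℝ, conj (G (-t)) = G t := fun t => conj_weilConv_weilReflect_neg b t
    have hP : 0 ≤ (weilPrimeTerm G).re := by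
      refine re_weilPrimeTerm_nonneg hGt.2 hsym fun n hn => ?_
      have h2 : (2 : ℝ) ≤ n := by exact_mod_cast hn
      have hlog : Real.log 2 ≤ |Real.log n| :=
        (Real.log_le_log (by norm_num) h2).trans (le_abs_self _)
      rw [hGzero _ hlog, Complex.zero_re]
    rw [hdec, Complex.add_re]
    exact add_nonneg hQ hP
  have hneg : weilPolarTerm F + weilArchTerm F = -(weilPolarTerm G + weilArchTerm G) := weilArchPolar_neg G
  have hF0 : (F 0).re = -(G 0).re := by simp [hFdef]
  have hG0 : 0 < (G 0).re := re_weilConv_bump2_zero_pos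
  rw [hneg, hF0, Complex.neg_re] at key
  linarith

end Summit.RiemannHypothesis.RiemannHypothesis.Theorems.SignConeFarField.Negative

end
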